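import Mathlib
import Summits.RiemannHypothesis.RiemannHypothesis.Theorems.WeilParityOffLineParityDetectionTorusGramIntegrals
import Summits.RiemannHypothesis.RiemannHypothesis.Theorems.WeilParityOffLineParityDetectionStubEvenOffLineCauchySchwarz
import HarnessLib

/-!
# Gram forms of the cosine / sine families (helper file for stub TORUS-SEP)

Route `WeilParity`, crux `OffLineParityDetection` (item stmt-RiemannHypothesis-15431), line
`registered`, stub `stub_torusTopHeavySeparated` (TORUS-SEP).  Real analysis on `L²(0, ∞)` written
with plain set integrals `∫ u in Ioi 0, …`; no zeta facts, no definitions.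

For `η > 0` and a phase point `a` the families are `c_g(u) = e^{-ηu} cos(g(u-a))`,
`s_g(u) = e^{-ηu} sin(g(u-a))`.  This file provides:

* the NORMAL FORM of one term of the mirror-pairing form (TORUS-analysis §1): for a real profile
  `f` and `Re ρ = 1/2 + η`,
  `Re(e^{2i(Im ρ)a} F_f(ρ)²) = ⟨f, c_{|Im ρ|}⟩² - ⟨f, s_{|Im ρ|}⟩²`, `F_f(ρ) = ∫₀^∞ f e^{-(ρ-1/2)u} du`;
* the Gram entries in closed form: `⟨c_g, c_h⟩ = (h_a(g-h) + h_a(g+h))/2`,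
  `⟨s_g, s_h⟩ = (h_a(g-h) - h_a(g+h))/2`, `⟨c_g, s_h⟩ = (q_a(g+h) + q_a(h-g))/2`
  (`h_a, q_a` the closed forms of the file `…TorusGramIntegrals`);
* finite-sum bookkeeping under the integral (`∫ k Σ αᵢ sᵢ`, `∫ (Σ αᵢ sᵢ)²`);
* the DANGER half of the one-sided test-vector lemma (TORUS-analysis §4 (a)): if
  `Σ_{ij} zᵢ zⱼ √mᵢ √mⱼ ⟨sᵢ, sⱼ⟩ ≤ Λ |z|²` for all `z`, then `Σᵢ mᵢ ⟨f, sᵢ⟩² ≤ Λ ‖f‖²` for every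
  profile `f` (Cauchy–Schwarz twice).

Everything is folklore and fully proved.
-/

set_option linter.dupNamespace false

noncomputable section

namespace Summit.RiemannHypothesis.RiemannHypothesis.Theorems.WeilParityOffLineParityDetection

open MeasureTheory Set Filter Finset
open scoped Topology

/-! ## Finite sums under the integral -/

/-- `∫ k · (Σᵢ αᵢ sᵢ) = Σᵢ αᵢ ∫ k sᵢ` when each `k sᵢ` is integrable. [folklore] -/
theorem torusSep_integral_mul_sum {ι : Type*} (S : Finset ι) {μ : Measure ℝ} (k : ℝ → ℝ)
    (s : ι → ℝ → ℝ) (α : ι → ℝ) (hks : ∀ i ∈ S, Integrable (fun u ↦ k u * s i u) μ) :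
    ∫ u, k u * ∑ i ∈ S, α i * s i u ∂μ = ∑ i ∈ S, α i * ∫ u, k u * s i u ∂μ := by
  have e : (fun u ↦ k u * ∑ i ∈ S, α i * s i u) = fun u ↦ ∑ i ∈ S, α i * (k u * s i u) := by
    funext u
    rw [Finset.mul_sum]
    refine Finset.sum_congr rfl fun i _ ↦ ?_
    ring
  rw [e, integral_finsetSum S fun i hi ↦ (hks i hi).const_mul (α i)]
  refine Finset.sum_congr rfl fun i _ ↦ ?_
  exact integral_const_mul _ _

/-- `(Σᵢ αᵢ sᵢ)² = Σᵢ Σⱼ αᵢ αⱼ sᵢ sⱼ` pointwise. [folklore] -/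
theorem torusSep_sum_sq_expand {ι : Type*} (S : Finset ι) (s : ι → ℝ → ℝ) (α : ι → ℝ) (u : ℝ) :
    (∑ i ∈ S, α i * s i u) ^ 2 = ∑ i ∈ S, ∑ j ∈ S, α i * α j * (s i u * s j u) := by
  rw [sq, Finset.sum_mul_sum]
  refine Finset.sum_congr rfl fun i _ ↦ Finset.sum_congr rfl fun j _ ↦ ?_
  ring

/-- `(Σᵢ αᵢ sᵢ)²` is integrable when all products `sᵢ sⱼ` are. [folklore] -/
theorem torusSep_integrable_sum_sq {ι : Type*} (S : Finset ι) {μ : Measure ℝ} (s : ι → ℝ → ℝ)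
    (α : ι → ℝ) (hss : ∀ i ∈ S, ∀ j ∈ S, Integrable (fun u ↦ s i u * s j u) μ) :
    Integrable (fun u ↦ (∑ i ∈ S, α i * s i u) ^ 2) μ := by
  simp_rw [torusSep_sum_sq_expand]
  refine integrable_finsetSum S fun i hi ↦ integrable_finsetSum S fun j hj ↦ ?_
  exact (hss i hi j hj).const_mul _

/-- `∫ (Σᵢ αᵢ sᵢ)² = Σᵢ Σⱼ αᵢ αⱼ ∫ sᵢ sⱼ` when all products `sᵢ sⱼ` are integrable. [folklore] -/
theorem torusSep_integral_sum_sq {ι : Type*} (S : Finset ι) {μ : Measure ℝ} (s : ι → ℝ → ℝ)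
    (α : ι → ℝ) (hss : ∀ i ∈ S, ∀ j ∈ S, Integrable (fun u ↦ s i u * s j u) μ) :
    ∫ u, (∑ i ∈ S, α i * s i u) ^ 2 ∂μ = ∑ i ∈ S, ∑ j ∈ S, α i * α j * ∫ u, s i u * s j u ∂μ := by
  simp_rw [torusSep_sum_sq_expand]
  rw [integral_finsetSum S fun i hi ↦ integrable_finsetSum S fun j hj ↦ (hss i hi j hj).const_mul _]
  refine Finset.sum_congr rfl fun i hi ↦ ?_
  rw [integral_finsetSum S fun j hj ↦ (hss i hi j hj).const_mul _]
  refine Finset.sum_congr rfl fun j _ ↦ ?_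
  exact integral_const_mul _ _

/-- `∫ (Σᵢ αᵢ sᵢ) k = Σᵢ αᵢ ∫ sᵢ k` when each `sᵢ k` is integrable. [folklore] -/
theorem torusSep_integral_sum_mul {ι : Type*} (S : Finset ι) {μ : Measure ℝ} (k : ℝ → ℝ)
    (s : ι → ℝ → ℝ) (α : ι → ℝ) (hsk : ∀ i ∈ S, Integrable (fun u ↦ s i u * k u) μ) :
    ∫ u, (∑ i ∈ S, α i * s i u) * k u ∂μ = ∑ i ∈ S, α i * ∫ u, s i u * k u ∂μ := by
  have e : (fun u ↦ (∑ i ∈ S, α i * s i u) * k u) = fun u ↦ k u * ∑ i ∈ S, α i * s i u := by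
    funext u
    ring
  rw [e, torusSep_integral_mul_sum S k s α fun i hi ↦ (hsk i hi).congr
    (ae_of_all _ fun u ↦ by simp only [mul_comm])]
  refine Finset.sum_congr rfl fun i _ ↦ ?_
  congr 1
  exact integral_congr_ae (ae_of_all _ fun u ↦ by simp only [mul_comm])

/-! ## The danger half of the one-sided test-vector lemma -/

/-- **Danger bound** (TORUS-analysis §4 (a)).  Let `sᵢ` be finitely many continuous functions with
all products `sᵢ sⱼ` integrable on `(0, ∞)` and Gram entries `SSᵢⱼ = ∫₀^∞ sᵢ sⱼ`, weights `mᵢ ≥ 0`,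
and suppose the Rayleigh bound `Σᵢⱼ zᵢ zⱼ √mᵢ √mⱼ SSᵢⱼ ≤ Λ Σ zᵢ²` (`Λ ≥ 0`).  Then for every
continuous compactly supported real `f`: `Σᵢ mᵢ (∫₀^∞ f sᵢ)² ≤ Λ ∫₀^∞ f²`.  Proof: with
`vᵢ = √mᵢ ∫ f sᵢ`, `|v|² = ∫ f · (Σ vᵢ √mᵢ sᵢ) ≤ ‖f‖ · (Λ |v|²)^{1/2}`. [folklore] -/
theorem torusSep_danger_bound {ι : Type*} [Fintype ι] (m : ι → ℝ) (hm : ∀ i, 0 ≤ m i)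
    (s : ι → ℝ → ℝ) (hsc : ∀ i, Continuous (s i))
    (hss : ∀ i j, IntegrableOn (fun u ↦ s i u * s j u) (Ioi 0)) (SS : ι → ι → ℝ)
    (hSS : ∀ i j, SS i j = ∫ u in Ioi (0 : ℝ), s i u * s j u) (Λ : ℝ) (hΛ0 : 0 ≤ Λ)
    (hΛ : ∀ z : ι → ℝ, ∑ i, ∑ j, z i * z j * (Real.sqrt (m i) * Real.sqrt (m j) * SS i j) ≤
      Λ * ∑ i, z i ^ 2)
    {f : ℝ → ℝ} (hf : Continuous f) (hfs : HasCompactSupport f) :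
    ∑ i, m i * (∫ u in Ioi (0 : ℝ), f u * s i u) ^ 2 ≤ Λ * ∫ u in Ioi (0 : ℝ), f u ^ 2 := by
  set v : ι → ℝ := fun i ↦ Real.sqrt (m i) * ∫ u in Ioi (0 : ℝ), f u * s i u with hv
  have hv2 : ∑ i, v i ^ 2 = ∑ i, m i * (∫ u in Ioi (0 : ℝ), f u * s i u) ^ 2 := by
    refine Finset.sum_congr rfl fun i _ ↦ ?_
    rw [hv]
    dsimp only
    rw [mul_pow, Real.sq_sqrt (hm i)]
  rw [← hv2]
  -- integrability facts
  have hfs_i : ∀ i, Integrable (fun u ↦ f u * s i u) (volume.restrict (Ioi (0 : ℝ))) := fun i ↦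
    ((hf.mul (hsc i)).integrable_of_hasCompactSupport hfs.mul_right).integrableOn
  have hf2 : Integrable (fun u ↦ f u ^ 2) (volume.restrict (Ioi (0 : ℝ))) :=
    (((hf.mul hf).integrable_of_hasCompactSupport hfs.mul_right).integrableOn (s := Ioi 0)).congr
      (ae_of_all _ fun u ↦ (sq (f u)).symm)
  set Sv : ℝ → ℝ := fun u ↦ ∑ i, (v i * Real.sqrt (m i)) * s i u with hSv
  have hSv2 : Integrable (fun u ↦ Sv u ^ 2) (volume.restrict (Ioi (0 : ℝ))) :=
    torusSep_integrable_sum_sq univ s _ fun i _ j _ ↦ hss i j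
  have hfSv : Integrable (fun u ↦ f u * Sv u) (volume.restrict (Ioi (0 : ℝ))) := by
    have e : (fun u ↦ f u * Sv u) = fun u ↦ ∑ i, (v i * Real.sqrt (m i)) * (f u * s i u) := by
      funext u
      rw [hSv]
      dsimp only
      rw [Finset.mul_sum]
      refine Finset.sum_congr rfl fun i _ ↦ ?_
      ring
    rw [e]
    exact integrable_finsetSum univ fun i _ ↦ (hfs_i i).const_mul _
  -- `|v|² = ∫ f · Sv`
  have hnorm : ∑ i, v i ^ 2 = ∫ u in Ioi (0 : ℝ), f u * Sv u := by
    rw [hSv]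
    dsimp only
    rw [torusSep_integral_mul_sum univ f s _ fun i _ ↦ hfs_i i]
    refine Finset.sum_congr rfl fun i _ ↦ ?_
    rw [hv]
    ring
  -- `∫ Sv² = Q_S(v) ≤ Λ |v|²`
  have hSvsq : ∫ u in Ioi (0 : ℝ), Sv u ^ 2 ≤ Λ * ∑ i, v i ^ 2 := by
    rw [hSv]
    dsimp only
    rw [torusSep_integral_sum_sq univ s _ fun i _ j _ ↦ hss i j]
    have e : ∑ i, ∑ j, v i * Real.sqrt (m i) * (v j * Real.sqrt (m j)) *
        ∫ u in Ioi (0 : ℝ), s i u * s j u =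
        ∑ i, ∑ j, v i * v j * (Real.sqrt (m i) * Real.sqrt (m j) * SS i j) := by
      refine Finset.sum_congr rfl fun i _ ↦ Finset.sum_congr rfl fun j _ ↦ ?_
      rw [hSS i j]
      ring
    rw [e]
    exact hΛ v
  -- Cauchy–Schwarz and the conclusion
  have hCS := sq_integral_mul_le hf2 hSv2 hfSv
  have hV0 : 0 ≤ ∑ i, v i ^ 2 := Finset.sum_nonneg fun i _ ↦ sq_nonneg _
  have hF0 : 0 ≤ ∫ u in Ioi (0 : ℝ), f u ^ 2 := integral_nonneg fun u ↦ sq_nonneg _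
  rcases hV0.eq_or_lt with hV | hV
  · rw [← hV]
    exact mul_nonneg hΛ0 hF0
  · -- `|v|⁴ ≤ ‖f‖² Λ |v|²`
    have h1 : (∑ i, v i ^ 2) ^ 2 ≤ (∫ u in Ioi (0 : ℝ), f u ^ 2) * (Λ * ∑ i, v i ^ 2) := by
      rw [hnorm] at hV ⊢
      exact hCS.trans (mul_le_mul_of_nonneg_left (by rwa [← hnorm]) hF0)
    nlinarith

/-! ## The cosine and sine families: Gram entries in closed form -/

/-- Integrability on `(0, ∞)` of a product `e^{-ηu} k₁ · e^{-ηu} k₂` with `|k₁|, |k₂| ≤ 1`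
continuous (`η > 0`). [folklore] -/
theorem torusSep_integrableOn_prod {η : ℝ} (hη : 0 < η) {k₁ k₂ : ℝ → ℝ} (hk₁ : Continuous k₁)
    (hk₂ : Continuous k₂) (h₁ : ∀ u, |k₁ u| ≤ 1) (h₂ : ∀ u, |k₂ u| ≤ 1) :
    IntegrableOn (fun u ↦ Real.exp (-(η * u)) * k₁ u * (Real.exp (-(η * u)) * k₂ u)) (Ioi 0) := by
  have e : (fun u ↦ Real.exp (-(η * u)) * k₁ u * (Real.exp (-(η * u)) * k₂ u)) =
      fun u ↦ Real.exp (-(2 * η * u)) * (k₁ u * k₂ u) := by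
    funext u
    have : Real.exp (-(2 * η * u)) = Real.exp (-(η * u)) * Real.exp (-(η * u)) := by
      rw [← Real.exp_add]
      ring_nf
    rw [this]
    ring
  rw [e]
  refine torusSep_integrableOn_exp_mul hη (by fun_prop : Continuous fun u ↦ k₁ u * k₂ u)
    (fun u ↦ ?_) 0
  rw [abs_mul]
  exact mul_le_one₀ (h₁ u) (abs_nonneg _) (h₂ u)

/-- `⟨c_g, c_h⟩ = (h_a(g-h) + h_a(g+h))/2` on `(0, ∞)`. [folklore] -/
theorem torusSep_gram_cc {η : ℝ} (hη : 0 < η) (a g h : ℝ) {H : ℝ → ℝ}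
    (hH : ∀ ω, H ω = (2 * η * Real.cos (ω * a) + ω * Real.sin (ω * a)) / (4 * η ^ 2 + ω ^ 2)) :
    ∫ u in Ioi (0 : ℝ), Real.exp (-(η * u)) * Real.cos (g * (u - a)) *
        (Real.exp (-(η * u)) * Real.cos (h * (u - a))) = (H (g - h) + H (g + h)) / 2 := by
  have e : ∀ u : ℝ, Real.exp (-(η * u)) * Real.cos (g * (u - a)) *
      (Real.exp (-(η * u)) * Real.cos (h * (u - a))) =
      (Real.exp (-(2 * η * u)) * Real.cos ((g - h) * (u - a)) +
        Real.exp (-(2 * η * u)) * Real.cos ((g + h) * (u - a))) / 2 := by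
    intro u
    have h2 : Real.exp (-(2 * η * u)) = Real.exp (-(η * u)) * Real.exp (-(η * u)) := by
      rw [← Real.exp_add]
      ring_nf
    have hc := Real.two_mul_cos_mul_cos (g * (u - a)) (h * (u - a))
    rw [show g * (u - a) - h * (u - a) = (g - h) * (u - a) by ring,
      show g * (u - a) + h * (u - a) = (g + h) * (u - a) by ring] at hc
    rw [h2, ← mul_add, ← hc]
    ring
  simp_rw [e]
  rw [integral_div, integral_add (torusSep_integrableOn_exp_cos hη _ a 0)
    (torusSep_integrableOn_exp_cos hη _ a 0), torusSep_integral_exp_cos hη,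
    torusSep_integral_exp_cos hη, hH, hH]

/-- `⟨s_g, s_h⟩ = (h_a(g-h) - h_a(g+h))/2` on `(0, ∞)`. [folklore] -/
theorem torusSep_gram_ss {η : ℝ} (hη : 0 < η) (a g h : ℝ) {H : ℝ → ℝ}
    (hH : ∀ ω, H ω = (2 * η * Real.cos (ω * a) + ω * Real.sin (ω * a)) / (4 * η ^ 2 + ω ^ 2)) :
    ∫ u in Ioi (0 : ℝ), Real.exp (-(η * u)) * Real.sin (g * (u - a)) *
        (Real.exp (-(η * u)) * Real.sin (h * (u - a))) = (H (g - h) - H (g + h)) / 2 := by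
  have e : ∀ u : ℝ, Real.exp (-(η * u)) * Real.sin (g * (u - a)) *
      (Real.exp (-(η * u)) * Real.sin (h * (u - a))) =
      (Real.exp (-(2 * η * u)) * Real.cos ((g - h) * (u - a)) -
        Real.exp (-(2 * η * u)) * Real.cos ((g + h) * (u - a))) / 2 := by
    intro u
    have h2 : Real.exp (-(2 * η * u)) = Real.exp (-(η * u)) * Real.exp (-(η * u)) := by
      rw [← Real.exp_add]
      ring_nf
    have hc := Real.two_mul_sin_mul_sin (g * (u - a)) (h * (u - a))
    rw [show g * (u - a) - h * (u - a) = (g - h) * (u - a) by ring,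
      show g * (u - a) + h * (u - a) = (g + h) * (u - a) by ring] at hc
    rw [h2, ← mul_sub, ← hc]
    ring
  simp_rw [e]
  rw [integral_div, integral_sub (torusSep_integrableOn_exp_cos hη _ a 0)
    (torusSep_integrableOn_exp_cos hη _ a 0), torusSep_integral_exp_cos hη,
    torusSep_integral_exp_cos hη, hH, hH]

/-- `⟨c_g, s_h⟩ = (q_a(h-g) + q_a(h+g))/2` on `(0, ∞)`. [folklore] -/
theorem torusSep_gram_cs {η : ℝ} (hη : 0 < η) (a g h : ℝ) {Q : ℝ → ℝ}
    (hQ : ∀ ω, Q ω = (ω * Real.cos (ω * a) - 2 * η * Real.sin (ω * a)) / (4 * η ^ 2 + ω ^ 2)) :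
    ∫ u in Ioi (0 : ℝ), Real.exp (-(η * u)) * Real.cos (g * (u - a)) *
        (Real.exp (-(η * u)) * Real.sin (h * (u - a))) = (Q (h - g) + Q (h + g)) / 2 := by
  have e : ∀ u : ℝ, Real.exp (-(η * u)) * Real.cos (g * (u - a)) *
      (Real.exp (-(η * u)) * Real.sin (h * (u - a))) =
      (Real.exp (-(2 * η * u)) * Real.sin ((h - g) * (u - a)) +
        Real.exp (-(2 * η * u)) * Real.sin ((h + g) * (u - a))) / 2 := by
    intro u
    have h2 : Real.exp (-(2 * η * u)) = Real.exp (-(η * u)) * Real.exp (-(η * u)) := by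
      rw [← Real.exp_add]
      ring_nf
    have hc := Real.two_mul_sin_mul_cos (h * (u - a)) (g * (u - a))
    rw [show h * (u - a) - g * (u - a) = (h - g) * (u - a) by ring,
      show h * (u - a) + g * (u - a) = (h + g) * (u - a) by ring] at hc
    rw [h2, ← mul_add, ← hc]
    ring
  simp_rw [e]
  rw [integral_div, integral_add (torusSep_integrableOn_exp_sin hη _ a 0)
    (torusSep_integrableOn_exp_sin hη _ a 0), torusSep_integral_exp_sin hη,
    torusSep_integral_exp_sin hη, hQ, hQ]

/-! ## The normal form of one term of the mirror-pairing form -/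

/-- Pointwise: `e^{i γ a} · f(u) e^{-(ρ-1/2)u} = f(u)e^{-ηu}cos(γ(u-a)) - i f(u)e^{-ηu}sin(γ(u-a))`
for `Re ρ = 1/2 + η`, `γ = Im ρ`. [folklore] -/
theorem torusSep_phase_mul_integrand {η : ℝ} {ρ : ℂ} (hρ : ρ.re = 1 / 2 + η) (a : ℝ) (f : ℝ → ℝ)
    (u : ℝ) :
    Complex.exp ((ρ.im : ℂ) * (a : ℂ) * Complex.I) *
        ((f u : ℂ) * Complex.exp (-((ρ - 1 / 2) * (u : ℂ)))) =
      ((f u * (Real.exp (-(η * u)) * Real.cos (ρ.im * (u - a))) : ℝ) : ℂ) -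
        ((f u * (Real.exp (-(η * u)) * Real.sin (ρ.im * (u - a))) : ℝ) : ℂ) * Complex.I := by
  rw [mul_left_comm, ← Complex.exp_add]
  have hz_re : ((ρ.im : ℂ) * (a : ℂ) * Complex.I + -((ρ - 1 / 2) * (u : ℂ))).re = -(η * u) := by
    simp [Complex.mul_re, hρ]
  have hz_im : ((ρ.im : ℂ) * (a : ℂ) * Complex.I + -((ρ - 1 / 2) * (u : ℂ))).im =
      -(ρ.im * (u - a)) := by
    simp [Complex.mul_im]
    ring
  apply Complex.ext
  · simp only [Complex.mul_re, Complex.ofReal_re, Complex.ofReal_im, Complex.exp_re,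
      Complex.exp_im, hz_re, hz_im, Real.cos_neg, Real.sin_neg, Complex.sub_re, Complex.I_re,
      Complex.I_im]
    ring
  · simp only [Complex.mul_im, Complex.ofReal_re, Complex.ofReal_im, Complex.exp_re,
      Complex.exp_im, hz_re, hz_im, Real.cos_neg, Real.sin_neg, Complex.sub_im, Complex.I_re,
      Complex.I_im]
    ring

/-- **Normal form of one term** (TORUS-analysis §1.1): for a continuous compactly supported real
`f`, `Re ρ = 1/2 + η` and `γ = Im ρ`,
`Re(e^{2iγa} F_f(ρ)²) = (∫₀^∞ f e^{-ηu} cos(γ(u-a)))² - (∫₀^∞ f e^{-ηu} sin(γ(u-a)))²`. [folklore] -/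
theorem torusSep_re_phase_laplace_sq {f : ℝ → ℝ} (hf : Continuous f) (hfs : HasCompactSupport f)
    {η : ℝ} {ρ : ℂ} (hρ : ρ.re = 1 / 2 + η) (a : ℝ) :
    (Complex.exp (2 * (ρ.im : ℂ) * (a : ℂ) * Complex.I) *
        (∫ u in Ioi (0 : ℝ), (f u : ℂ) * Complex.exp (-((ρ - 1 / 2) * (u : ℂ)))) ^ 2).re =
      (∫ u in Ioi (0 : ℝ), f u * (Real.exp (-(η * u)) * Real.cos (ρ.im * (u - a)))) ^ 2 -
        (∫ u in Ioi (0 : ℝ), f u * (Real.exp (-(η * u)) * Real.sin (ρ.im * (u - a)))) ^ 2 := by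
  set e1 := Complex.exp ((ρ.im : ℂ) * (a : ℂ) * Complex.I) with he1
  have he2 : Complex.exp (2 * (ρ.im : ℂ) * (a : ℂ) * Complex.I) = e1 * e1 := by
    rw [he1, ← Complex.exp_add]
    ring_nf
  rw [he2, show ∀ F : ℂ, e1 * e1 * F ^ 2 = (e1 * F) ^ 2 from fun F ↦ by ring,
    ← integral_const_mul]
  simp_rw [he1, torusSep_phase_mul_integrand hρ a f]
  have hA : Integrable (fun u ↦ ((f u * (Real.exp (-(η * u)) * Real.cos (ρ.im * (u - a))) : ℝ) : ℂ))
      (volume.restrict (Ioi (0 : ℝ))) :=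
    ((hf.mul (by fun_prop)).integrable_of_hasCompactSupport hfs.mul_right).integrableOn.ofReal
  have hB : Integrable (fun u ↦ ((f u * (Real.exp (-(η * u)) * Real.sin (ρ.im * (u - a))) : ℝ) : ℂ)
      * Complex.I) (volume.restrict (Ioi (0 : ℝ))) :=
    ((hf.mul (by fun_prop)).integrable_of_hasCompactSupport hfs.mul_right).integrableOn.ofReal
      |>.mul_const _
  rw [integral_sub hA hB, integral_mul_const, integral_complex_ofReal, integral_complex_ofReal,
    sq, Complex.mul_re]
  simp only [Complex.sub_re, Complex.sub_im, Complex.mul_re, Complex.mul_im, Complex.ofReal_re,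
    Complex.ofReal_im, Complex.I_re, Complex.I_im]
  ring

/-- The same normal form with the ABSOLUTE ordinate `|Im ρ|` (cosine is even, sine is odd and
enters squared). [folklore] -/
theorem torusSep_re_phase_laplace_sq_abs {f : ℝ → ℝ} (hf : Continuous f)
    (hfs : HasCompactSupport f) {η : ℝ} {ρ : ℂ} (hρ : ρ.re = 1 / 2 + η) (a : ℝ) :
    (Complex.exp (2 * (ρ.im : ℂ) * (a : ℂ) * Complex.I) *
        (∫ u in Ioi (0 : ℝ), (f u : ℂ) * Complex.exp (-((ρ - 1 / 2) * (u : ℂ)))) ^ 2).re =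
      (∫ u in Ioi (0 : ℝ), f u * (Real.exp (-(η * u)) * Real.cos (|ρ.im| * (u - a)))) ^ 2 -
        (∫ u in Ioi (0 : ℝ), f u * (Real.exp (-(η * u)) * Real.sin (|ρ.im| * (u - a)))) ^ 2 := by
  rw [torusSep_re_phase_laplace_sq hf hfs hρ a]
  rcases abs_choice ρ.im with h | h
  · rw [h]
  · rw [h]
    simp only [neg_mul, Real.cos_neg, Real.sin_neg, mul_neg, integral_neg, neg_sq]

/-! ## Summary statement (the registered sub-goal of this helper file) -/

/-- **Gram forms** (summary of this file): the normal form of one term of the mirror-pairing form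
with the absolute ordinate, and the three Gram entries of the cosine / sine families in closed
form. [folklore] -/
theorem torusSep_gramForms :
    ∀ η : ℝ, 0 < η → ∀ a : ℝ,
      (∀ f : ℝ → ℝ, Continuous f → HasCompactSupport f → ∀ ρ : ℂ, ρ.re = 1 / 2 + η →
        (Complex.exp (2 * (ρ.im : ℂ) * (a : ℂ) * Complex.I) *
          (∫ u in Set.Ioi (0 : ℝ), (f u : ℂ) * Complex.exp (-((ρ - 1 / 2) * (u : ℂ)))) ^ 2).re =
        (∫ u in Set.Ioi (0 : ℝ), f u * (Real.exp (-(η * u)) * Real.cos (|ρ.im| * (u - a)))) ^ 2 -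
          (∫ u in Set.Ioi (0 : ℝ), f u * (Real.exp (-(η * u)) * Real.sin (|ρ.im| * (u - a)))) ^ 2) ∧
      (∀ g h : ℝ,
        ∫ u in Set.Ioi (0 : ℝ), Real.exp (-(η * u)) * Real.cos (g * (u - a)) *
            (Real.exp (-(η * u)) * Real.cos (h * (u - a))) =
          ((2 * η * Real.cos ((g - h) * a) + (g - h) * Real.sin ((g - h) * a)) /
              (4 * η ^ 2 + (g - h) ^ 2) +
            (2 * η * Real.cos ((g + h) * a) + (g + h) * Real.sin ((g + h) * a)) /
              (4 * η ^ 2 + (g + h) ^ 2)) / 2) ∧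
      (∀ g h : ℝ,
        ∫ u in Set.Ioi (0 : ℝ), Real.exp (-(η * u)) * Real.sin (g * (u - a)) *
            (Real.exp (-(η * u)) * Real.sin (h * (u - a))) =
          ((2 * η * Real.cos ((g - h) * a) + (g - h) * Real.sin ((g - h) * a)) /
              (4 * η ^ 2 + (g - h) ^ 2) -
            (2 * η * Real.cos ((g + h) * a) + (g + h) * Real.sin ((g + h) * a)) /
              (4 * η ^ 2 + (g + h) ^ 2)) / 2) ∧
      (∀ g h : ℝ,
        ∫ u in Set.Ioi (0 : ℝ), Real.exp (-(η * u)) * Real.cos (g * (u - a)) *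
            (Real.exp (-(η * u)) * Real.sin (h * (u - a))) =
          (((h - g) * Real.cos ((h - g) * a) - 2 * η * Real.sin ((h - g) * a)) /
              (4 * η ^ 2 + (h - g) ^ 2) +
            ((h + g) * Real.cos ((h + g) * a) - 2 * η * Real.sin ((h + g) * a)) /
              (4 * η ^ 2 + (h + g) ^ 2)) / 2) :=
  fun η hη a ↦ ⟨fun _ hf hfs _ hρ ↦ torusSep_re_phase_laplace_sq_abs hf hfs hρ a,
    fun g h ↦ torusSep_gram_cc hη a g h (H := fun ω ↦
      (2 * η * Real.cos (ω * a) + ω * Real.sin (ω * a)) / (4 * η ^ 2 + ω ^ 2)) (fun _ ↦ rfl),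
    fun g h ↦ torusSep_gram_ss hη a g h (H := fun ω ↦
      (2 * η * Real.cos (ω * a) + ω * Real.sin (ω * a)) / (4 * η ^ 2 + ω ^ 2)) (fun _ ↦ rfl),
    fun g h ↦ torusSep_gram_cs hη a g h (Q := fun ω ↦
      (ω * Real.cos (ω * a) - 2 * η * Real.sin (ω * a)) / (4 * η ^ 2 + ω ^ 2)) (fun _ ↦ rfl)⟩

end Summit.RiemannHypothesis.RiemannHypothesis.Theorems.WeilParityOffLineParityDetection

end
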